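import Literature.Analysis.FluidPDE.SolenoidalL2Duality
import Literature.Analysis.FluidPDE.MollifiedField
import Literature.Analysis.FluidPDE.LerayHopfTimeSlice
import Literature.Analysis.FunctionSpaces.TimeMollification
import Literature.Analysis.FunctionSpaces.MollificationLp
import HarnessLib

/-!
# Mollified solenoidal fields as test fields in the time-sliced weak formulations

Analysis/FluidPDE support file (serves the discharge of the barrier fact
`Literature.Barriers.AnomalousDissipation.BrenierDeLellisSzekelyhidi2011_cor1`, Brenier–De Lellis–
Székelyhidi 2011, Cor. 1). The relative-energy argument pairs a Leray–Hopf solution `u` with the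
spatial mollification `φ ⋆ v(σ)` of the Euler solution and the Euler solution with `φ ⋆ u(s)`;
these fields are smooth, divergence free and in every Sobolev space, but *not* compactly
supported, so the accepted weak formulations (smooth compactly supported divergence-free tests)
have to be extended to them. For mollified fields this needs no solenoidal truncation: if
`ψⱼ ∈ 𝒱 = C^∞_{c,σ}` tends to `w` in `L²` (density of `𝒱` in `L²_σ`, accepted
`denseRange_divFreeTestToSolenoidalL2` with `mem_solenoidalL2_iff_holds`), then `φ ⋆ ψⱼ ∈ 𝒱` and
`φ ⋆ ψⱼ → φ ⋆ w` uniformly with all derivatives (`‖D(φ ⋆ f)‖_∞ ≤ ‖Dφ‖₂ ‖f‖₂`,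
`‖Δ(φ ⋆ f)‖₂ ≤ ‖Δφ‖₁ ‖f‖₂`).

## Main results

* `enorm_convolution_lsmul_le`, `norm_fderiv_normed_convolution_le`,
  `eLpNorm_laplacian_normed_convolution_le`: `L² → L^∞ / L²` bounds for mollified fields.
* `exists_divFreeTest_tendsto_eLpNorm`: an `L²`, weakly divergence-free field is the `L²` limit
  of smooth compactly supported divergence-free fields.
* `normed_convolution_mem_divFreeTest`: `φ ⋆ ψ ∈ 𝒱` for `ψ ∈ 𝒱`.
* `IsLerayHopfOn.inner_normed_convolution_eq`: the time-sliced weak formulation of an unforced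
  Leray–Hopf solution (accepted `IsLerayHopfOn.inner_test_eq`, Serrin 1963, §3 (6); Galdi 2000,
  Lemma 2.1) tested with `Ψ = φ ⋆ w`, `w ∈ L²` weakly divergence free:
  `⟨u(t), Ψ⟩ = ⟨u₀, Ψ⟩ + ∫₀ᵗ ∫ (⟪u, (u·∇)Ψ⟫ + ν ⟪u, ΔΨ⟫)` for every `t ∈ (0, T]`.
* `IsWeakNSSolutionOn.inner_test_eq_of_continuousInLpOn`: the time-sliced weak formulation for a
  weak solution that is continuous into `L²` on `[0, T]` (smooth compactly supported
  divergence-free tests, every `t ∈ [0, T]`; in particular `⟨u(0), Ψ⟩ = ⟨u₀, Ψ⟩`).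

## Mathlib / tree search

Mathlib: convolution calculus (`HasCompactSupport.contDiff_convolution_left`,
`HasCompactSupport.convolution`), `DenseRange`, `mem_closure_iff_seq_limit`, `Lp`. Tree: the
solenoidal space and its density statement (`LerayProjector`, `SolenoidalL2Duality`), mollified
fields (`MollifiedField`, `Mollification`, `MollificationLp`, `HelmholtzAnnihilator` for
`Δ(φ ⋆ g) = (Δφ) ⋆ g`), Young's inequality (`UnboundedOperators.HeatKernel`), the time-sliced
formulation for test fields (`LerayHopfTimeSlice`, `DuBoisReymond`). Nothing on non-compactly
supported tests besides the `H¹_σ` slice identity in dimension `3` (`LerayHopfH1Test`), which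
needs `∇Ψ ∈ L²` bounds not available here.

## References

* J. Serrin, *The initial value problem for the Navier–Stokes equations*, in: Nonlinear Problems
  (Madison 1962), Univ. Wisconsin Press 1963, §3, (6). [Serrin1963]
* G. P. Galdi, *An introduction to the Navier–Stokes initial-boundary value problem*,
  Birkhäuser 2000, Lemma 2.1, Def. 2.1. [Galdi2000]
* Y. Brenier, C. De Lellis, L. Székelyhidi Jr., Comm. Math. Phys. 305 (2011), §3.1 (the fields
  served). [BrenierDeLellisSzekelyhidi2011]
-/

noncomputable section

open MeasureTheory TopologicalSpace Set Function Filter ContinuousLinearMap InnerProductSpace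
open scoped ENNReal NNReal Convolution RealInnerProductSpace Topology Laplacian

namespace Literature.Analysis.FluidPDE

variable {E : Type*} [NormedAddCommGroup E] [InnerProductSpace ℝ E] [FiniteDimensional ℝ E]
  [MeasurableSpace E] [BorelSpace E]

/-! ### `L²`-based bounds for mollified fields -/

section Bounds

variable {F : Type*} [NormedAddCommGroup F] [NormedSpace ℝ F]

/-- **Cauchy–Schwarz for a convolution**: `‖(k ⋆ f)(x)‖ ≤ ‖k‖_{L²} ‖f‖_{L²}` for every `x`
(translation invariance of Lebesgue measure and Hölder). [folklore] -/
theorem enorm_convolution_lsmul_le {k : E → ℝ} {f : E → F} (hk : AEStronglyMeasurable k volume)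
    (hf : AEStronglyMeasurable f volume) (x : E) :
    ‖(k ⋆[lsmul ℝ ℝ, volume] f) x‖ₑ ≤ eLpNorm k 2 volume * eLpNorm f 2 volume := by
  rw [convolution_def]
  simp only [lsmul_apply]
  have hfx : AEStronglyMeasurable (fun t => f (x - t)) volume :=
    hf.comp_measurePreserving (Measure.measurePreserving_sub_left volume x)
  have hfx2 : eLpNorm (fun t => f (x - t)) 2 volume = eLpNorm f 2 volume :=
    eLpNorm_comp_measurePreserving hf (Measure.measurePreserving_sub_left volume x)
  calc ‖∫ t, k t • f (x - t)‖ₑ ≤ ∫⁻ t, ‖k t • f (x - t)‖ₑ := enorm_integral_le_lintegral_enorm _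
    _ = ∫⁻ t, ‖k t‖ₑ * ‖f (x - t)‖ₑ := by simp_rw [enorm_smul]
    _ ≤ eLpNorm k 2 volume * eLpNorm (fun t => f (x - t)) 2 volume :=
        FunctionSpaces.lintegral_enorm_mul_enorm_le_eLpNorm_mul hk hfx
    _ = eLpNorm k 2 volume * eLpNorm f 2 volume := by rw [hfx2]

/-- The normalised bump kernel is in `L²`. [folklore] -/
theorem eLpNorm_normed_lt_top (φ : ContDiffBump (0 : E)) (p : ℝ≥0∞) :
    eLpNorm (φ.normed volume) p volume < ⊤ :=
  (φ.continuous_normed.memLp_of_hasCompactSupport (μ := volume) φ.hasCompactSupport_normed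
    (p := p)).eLpNorm_lt_top

/-- The derivative of the normalised bump kernel is in `L²`. [folklore] -/
theorem eLpNorm_fderiv_normed_lt_top (φ : ContDiffBump (0 : E)) (p : ℝ≥0∞) :
    eLpNorm (fderiv ℝ (φ.normed volume)) p volume < ⊤ :=
  (((φ.contDiff_normed (n := 1)).continuous_fderiv one_ne_zero).memLp_of_hasCompactSupport
    (μ := volume) (φ.hasCompactSupport_normed.fderiv ℝ) (p := p)).eLpNorm_lt_top

/-- **Uniform bound of a mollified `L²` field**: `‖(φ ⋆ f)(x)‖ ≤ ‖φ‖_{L²} ‖f‖_{L²}`. [folklore] -/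
theorem norm_normed_convolution_le (φ : ContDiffBump (0 : E)) {f : E → F} (hf : MemLp f 2 volume)
    (x : E) :
    ‖(φ.normed volume ⋆[lsmul ℝ ℝ, volume] f) x‖ ≤
      (eLpNorm (φ.normed volume) 2 volume).toReal * (eLpNorm f 2 volume).toReal := by
  rw [← ENNReal.toReal_mul, ← toReal_enorm]
  exact ENNReal.toReal_mono (ENNReal.mul_ne_top (eLpNorm_normed_lt_top φ 2).ne hf.eLpNorm_ne_top)
    (enorm_convolution_lsmul_le φ.continuous_normed.aestronglyMeasurable hf.1 x)

/-- **Uniform bound of the derivative of a mollified `L²` field**: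
`‖D(φ ⋆ f)(x)‖ ≤ ‖Dφ‖_{L²} ‖f‖_{L²}` (the derivative falls on the kernel,
`fderiv_convolution_lsmul_apply`, then Cauchy–Schwarz). [folklore] -/
theorem norm_fderiv_normed_convolution_le (φ : ContDiffBump (0 : E)) {f : E → F}
    (hf : MemLp f 2 volume) (x : E) :
    ‖fderiv ℝ (φ.normed volume ⋆[lsmul ℝ ℝ, volume] f) x‖ ≤
      (eLpNorm (fderiv ℝ (φ.normed volume)) 2 volume).toReal * (eLpNorm f 2 volume).toReal := by
  have hfl : LocallyIntegrable f volume := hf.locallyIntegrable one_le_two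
  have hD : Continuous (fderiv ℝ (φ.normed volume)) :=
    (φ.contDiff_normed (n := 1)).continuous_fderiv one_ne_zero
  refine opNorm_le_bound _ (by positivity) fun a => ?_
  rw [fderiv_convolution_lsmul_apply (φ.contDiff_normed (n := 1)) φ.hasCompactSupport_normed hfl]
  have hka : AEStronglyMeasurable (fun t => fderiv ℝ (φ.normed volume) t a) volume :=
    (hD.clm_apply continuous_const).aestronglyMeasurable
  have hka2 : eLpNorm (fun t => fderiv ℝ (φ.normed volume) t a) 2 volume ≤
      (‖a‖₊ : ℝ≥0∞) * eLpNorm (fderiv ℝ (φ.normed volume)) 2 volume := by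
    have h := eLpNorm_le_nnreal_smul_eLpNorm_of_ae_le_mul
      (f := fun t => fderiv ℝ (φ.normed volume) t a) (g := fderiv ℝ (φ.normed volume))
      (c := ‖a‖₊) (μ := volume) (ae_of_all _ fun t => ?_) 2
    · rwa [ENNReal.smul_def, smul_eq_mul] at h
    · rw [← NNReal.coe_le_coe]
      push_cast
      rw [mul_comm]
      exact le_opNorm _ _
  have h1 := enorm_convolution_lsmul_le hka hf.1 x
  have hfin : (‖a‖₊ : ℝ≥0∞) * eLpNorm (fderiv ℝ (φ.normed volume)) 2 volume *
      eLpNorm f 2 volume ≠ ⊤ :=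
    ENNReal.mul_ne_top (ENNReal.mul_ne_top ENNReal.coe_ne_top
      (eLpNorm_fderiv_normed_lt_top φ 2).ne) hf.eLpNorm_ne_top
  have h2 := ENNReal.toReal_mono hfin (h1.trans (mul_le_mul_left hka2 _))
  rw [toReal_enorm] at h2
  refine h2.trans_eq ?_
  rw [ENNReal.toReal_mul, ENNReal.toReal_mul]
  simp only [ENNReal.coe_toReal, coe_nnnorm]
  ring

/-- The mollification of a locally integrable field is smooth. [folklore] -/
theorem contDiff_normed_convolution_of_locallyIntegrable (φ : ContDiffBump (0 : E)) {f : E → F}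
    (hf : LocallyIntegrable f volume) {n : ℕ∞} :
    ContDiff ℝ n (φ.normed volume ⋆[lsmul ℝ ℝ, volume] f) :=
  φ.hasCompactSupport_normed.contDiff_convolution_left _ φ.contDiff_normed hf

/-- Linearity of convolution in the field: `k ⋆ (f - g) = k ⋆ f - k ⋆ g` for a continuous
compactly supported kernel `k` and locally integrable `f, g`. [folklore] -/
theorem convolution_lsmul_sub {k : E → ℝ} (hk : Continuous k) (hkc : HasCompactSupport k)
    {f g : E → F} (hf : LocallyIntegrable f volume) (hg : LocallyIntegrable g volume) :
    (k ⋆[lsmul ℝ ℝ, volume] (f - g)) = (k ⋆[lsmul ℝ ℝ, volume] f) - k ⋆[lsmul ℝ ℝ, volume] g := by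
  ext1 x
  have h1 : ConvolutionExistsAt k f x (lsmul ℝ ℝ) volume := hkc.convolutionExists_left _ hk hf x
  have h2 : ConvolutionExistsAt k g x (lsmul ℝ ℝ) volume := hkc.convolutionExists_left _ hk hg x
  rw [Pi.sub_apply, convolution_def, convolution_def, convolution_def, ← integral_sub h1 h2]
  refine integral_congr_ae (ae_of_all _ fun t => ?_)
  simp only [lsmul_apply, Pi.sub_apply, smul_sub]

/-- Linearity of mollification in the field: `φ ⋆ (f - g) = φ ⋆ f - φ ⋆ g` for locally
integrable `f, g`. [folklore] -/
theorem normed_convolution_sub (φ : ContDiffBump (0 : E)) {f g : E → F}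
    (hf : LocallyIntegrable f volume) (hg : LocallyIntegrable g volume) :
    (φ.normed volume ⋆[lsmul ℝ ℝ, volume] (f - g)) =
      (φ.normed volume ⋆[lsmul ℝ ℝ, volume] f) - φ.normed volume ⋆[lsmul ℝ ℝ, volume] g :=
  convolution_lsmul_sub φ.continuous_normed φ.hasCompactSupport_normed hf hg

/-- The Laplacian of the normalised bump kernel is compactly supported. [folklore] -/
theorem hasCompactSupport_laplacian_normed (φ : ContDiffBump (0 : E)) :
    HasCompactSupport (Δ (φ.normed volume) : E → ℝ) := by
  refine (φ.hasCompactSupport_normed (μ := volume)).mono' fun x hx => ?_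
  by_contra h
  exact hx (laplacian_eq_zero_of_notMem_tsupport h)

/-- The Laplacian of the normalised bump kernel is integrable. [folklore] -/
theorem integrable_laplacian_normed (φ : ContDiffBump (0 : E)) :
    Integrable (Δ (φ.normed volume)) (volume : Measure E) :=
  (continuous_laplacian (φ.contDiff_normed (n := 2))).integrable_of_hasCompactSupport
    (hasCompactSupport_laplacian_normed φ)

variable {F' : Type*} [NormedAddCommGroup F'] [InnerProductSpace ℝ F']

/-- **The Laplacian of a mollified `L²` field**: `Δ(φ ⋆ f) = (Δφ) ⋆ f` is in `L²` with
`‖Δ(φ ⋆ f)‖_{L²} ≤ ‖Δφ‖_{L¹} ‖f‖_{L²}` (`laplacian_convolution_lsmul` and Young). [folklore] -/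
theorem memLp_laplacian_normed_convolution (φ : ContDiffBump (0 : E)) {f : E → F'}
    (hf : MemLp f 2 volume) :
    MemLp (Δ (φ.normed volume ⋆[lsmul ℝ ℝ, volume] f)) 2 volume ∧
      eLpNorm (Δ (φ.normed volume ⋆[lsmul ℝ ℝ, volume] f)) 2 volume ≤
        (∫⁻ y, ‖(Δ (φ.normed volume)) y‖ₑ) * eLpNorm f 2 volume := by
  have hfl : LocallyIntegrable f volume := hf.locallyIntegrable one_le_two
  have heq : Δ (φ.normed volume ⋆[lsmul ℝ ℝ, volume] f) =
      (Δ (φ.normed volume)) ⋆[lsmul ℝ ℝ, volume] f := by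
    ext1 x
    exact laplacian_convolution_lsmul (φ.contDiff_normed (n := 2)) φ.hasCompactSupport_normed hfl x
  rw [heq]
  exact ⟨UnboundedOperators.memLp_convolution_lsmul (integrable_laplacian_normed φ) hf one_le_two,
    UnboundedOperators.eLpNorm_convolution_le_lintegral_enorm_mul
      (integrable_laplacian_normed φ).aestronglyMeasurable hf.1 one_le_two⟩

end Bounds

/-! ### Density of `𝒱` in the weakly divergence-free `L²` fields, sequential form -/

section Density

/-- **Sequential density of `𝒱` in `L²_σ`.** An `L²` weakly divergence-free field `w` is the
`L²` limit of smooth compactly supported divergence-free fields: `[w] ∈ L²_σ` by the accepted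
characterisation `mem_solenoidalL2_iff_holds` (Temam 1977, Ch. I, Thm. 1.4/1.6), and `𝒱` is dense
in `L²_σ` (`denseRange_divFreeTestToSolenoidalL2`). [cite: Temam1977, Ch. I Thm. 1.4 with Rem. 1.6 / Thm. 1.6] -/
theorem exists_divFreeTest_tendsto_eLpNorm {w : E → E} (hw : MemLp w 2 volume)
    (hdiv : IsWeaklyDivFree w) :
    ∃ ψ : ℕ → E → E, (∀ j, ψ j ∈ divFreeTest E) ∧
      Tendsto (fun j => eLpNorm (ψ j - w) 2 volume) atTop (𝓝 0) := by
  set W : Lp E 2 (volume : Measure E) := hw.toLp w with hW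
  have hWdiv : IsWeaklyDivFree (W : E → E) := hdiv.congr_ae hw.coeFn_toLp.symm
  have hWmem : W ∈ solenoidalL2 E := (mem_solenoidalL2_iff_holds W).2 hWdiv
  have hcl : (⟨W, hWmem⟩ : solenoidalL2 E) ∈ closure (range (divFreeTestToSolenoidalL2 E)) := by
    rw [(denseRange_divFreeTestToSolenoidalL2 (E := E)).closure_range]; trivial
  obtain ⟨x, hx, hlim⟩ := mem_closure_iff_seq_limit.1 hcl
  choose ψ hψ using hx
  refine ⟨fun j => (ψ j : E → E), fun j => (ψ j).2, ?_⟩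
  have hnorm : Tendsto (fun j => ‖(x j : Lp E 2 (volume : Measure E)) - W‖) atTop (𝓝 0) := by
    have h1 : Tendsto (fun j => (x j : Lp E 2 (volume : Measure E))) atTop (𝓝 W) :=
      (continuous_subtype_val.tendsto _).comp hlim
    rwa [tendsto_iff_norm_sub_tendsto_zero] at h1
  have heq : ∀ j, ‖(x j : Lp E 2 (volume : Measure E)) - W‖ =
      (eLpNorm ((ψ j : E → E) - w) 2 volume).toReal := by
    intro j
    rw [Lp.norm_def]
    congr 1
    refine eLpNorm_congr_ae ?_
    rw [← hψ j]
    filter_upwards [Lp.coeFn_sub (divFreeTestToL2 E (ψ j)) W, coeFn_divFreeTestToL2 (ψ j),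
      hw.coeFn_toLp] with y h1 h2 h3
    rw [coe_divFreeTestToSolenoidalL2, h1, Pi.sub_apply, h2, h3, Pi.sub_apply]
  simp_rw [heq] at hnorm
  have hfin : ∀ j, eLpNorm ((ψ j : E → E) - w) 2 volume ≠ ⊤ := fun j =>
    ((memLp_of_mem_divFreeTest (ψ j).2 2).sub hw).eLpNorm_ne_top
  exact (ENNReal.tendsto_toReal_zero_iff hfin).1 hnorm

/-- **Mollified test fields are test fields**: `φ ⋆ ψ ∈ 𝒱` for `ψ ∈ 𝒱` (smooth and compactly
supported as a convolution of such, divergence free by `divergence_convolution_eq_zero`). [folklore] -/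
theorem normed_convolution_mem_divFreeTest (φ : ContDiffBump (0 : E)) {ψ : E → E}
    (hψ : ψ ∈ divFreeTest E) : φ.normed volume ⋆[lsmul ℝ ℝ, volume] ψ ∈ divFreeTest E := by
  have hψl : LocallyIntegrable ψ volume :=
    hψ.1.contDiff.continuous.locallyIntegrable
  refine ⟨⟨contDiff_normed_convolution_of_locallyIntegrable φ hψl, ?_, by simp⟩, fun x => ?_⟩
  · exact φ.hasCompactSupport_normed.convolution _ hψ.1.hasCompactSupport
  · exact divergence_convolution_eq_zero φ.contDiff_normed φ.hasCompactSupport_normed hψl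
      (VectorCalculus.IsDivFree.isWeaklyDivFree_holds hψ.2 (hψ.1.contDiff.of_le (by exact_mod_cast le_top))) x

/-- The mollification of a locally integrable weakly divergence-free field is (classically)
divergence free. [folklore] -/
theorem isDivFree_normed_convolution_of_isWeaklyDivFree (φ : ContDiffBump (0 : E)) {w : E → E}
    (hw : LocallyIntegrable w volume) (hdiv : IsWeaklyDivFree w) :
    VectorCalculus.IsDivFree (φ.normed volume ⋆[lsmul ℝ ℝ, volume] w) := fun x =>
  divergence_convolution_eq_zero φ.contDiff_normed φ.hasCompactSupport_normed hw hdiv x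

/-- The mollification of a locally integrable weakly divergence-free field is weakly divergence
free. [folklore] -/
theorem isWeaklyDivFree_normed_convolution (φ : ContDiffBump (0 : E)) {w : E → E}
    (hw : LocallyIntegrable w volume) (hdiv : IsWeaklyDivFree w) :
    IsWeaklyDivFree (φ.normed volume ⋆[lsmul ℝ ℝ, volume] w) :=
  VectorCalculus.IsDivFree.isWeaklyDivFree_holds (isDivFree_normed_convolution_of_isWeaklyDivFree φ hw hdiv)
    (contDiff_normed_convolution_of_locallyIntegrable φ hw)

end Density

/-! ### `L²` pairings: bounds and limits -/

section Pairings

variable {X : Type*} [MeasurableSpace X] {μ : Measure X}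
variable {V : Type*} [NormedAddCommGroup V] [InnerProductSpace ℝ V]

omit [NormedAddCommGroup E] [InnerProductSpace ℝ E] [FiniteDimensional ℝ E] [MeasurableSpace E]
  [BorelSpace E] in
/-- Cauchy–Schwarz in real form: `|∫ ⟪a, b⟫| ≤ ‖a‖_{L²} ‖b‖_{L²}` for `a, b ∈ L²`. [folklore] -/
theorem abs_integral_inner_le_toReal_eLpNorm_mul {a b : X → V} (ha : MemLp a 2 μ) (hb : MemLp b 2 μ) :
    |∫ x, ⟪a x, b x⟫ ∂μ| ≤ (eLpNorm a 2 μ).toReal * (eLpNorm b 2 μ).toReal := by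
  rw [← ENNReal.toReal_mul, ← Real.norm_eq_abs, ← toReal_enorm]
  exact ENNReal.toReal_mono (ENNReal.mul_ne_top ha.eLpNorm_ne_top hb.eLpNorm_ne_top)
    (FunctionSpaces.enorm_integral_inner_le_eLpNorm_mul ha.1 hb.1)

omit [NormedAddCommGroup E] [InnerProductSpace ℝ E] [FiniteDimensional ℝ E] [MeasurableSpace E]
  [BorelSpace E] in
/-- A bounded measurable multiplier maps `L²` to `L²`: `‖A b‖_{L²} ≤ M ‖b‖_{L²}`. [folklore] -/
theorem memLp_clm_apply_of_norm_le {W : Type*} [NormedAddCommGroup W] [NormedSpace ℝ W]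
    {b : X → V} {A : X → V →L[ℝ] W} (hb : MemLp b 2 μ) (hA : AEStronglyMeasurable A μ)
    {M : ℝ≥0} (hM : ∀ x, ‖A x‖ ≤ M) :
    MemLp (fun x => A x (b x)) 2 μ ∧ eLpNorm (fun x => A x (b x)) 2 μ ≤ M * eLpNorm b 2 μ := by
  have hm : AEStronglyMeasurable (fun x => A x (b x)) μ :=
    (ContinuousLinearMap.id ℝ (V →L[ℝ] W)).aestronglyMeasurable_comp₂ hA hb.1
  have hle : eLpNorm (fun x => A x (b x)) 2 μ ≤ M * eLpNorm b 2 μ := by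
    have h := eLpNorm_le_nnreal_smul_eLpNorm_of_ae_le_mul (f := fun x => A x (b x)) (g := b)
      (c := M) (μ := μ) (ae_of_all _ fun x => ?_) 2
    · rwa [ENNReal.smul_def, smul_eq_mul] at h
    · rw [← NNReal.coe_le_coe]
      push_cast
      exact (le_opNorm _ _).trans (mul_le_mul_of_nonneg_right (hM x) (norm_nonneg _))
  exact ⟨⟨hm, hle.trans_lt (ENNReal.mul_lt_top ENNReal.coe_lt_top hb.eLpNorm_lt_top)⟩, hle⟩

omit [NormedAddCommGroup E] [InnerProductSpace ℝ E] [FiniteDimensional ℝ E] [MeasurableSpace E]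
  [BorelSpace E] in
/-- **A bounded multiplier between two `L²` fields**: `x ↦ ⟪a x, A x (b x)⟫` is integrable and
`|∫ ⟪a, A b⟫| ≤ M ‖a‖_{L²} ‖b‖_{L²}` when `‖A x‖ ≤ M` for all `x`. [folklore] -/
theorem abs_integral_inner_clm_apply_le_of_norm_le {W : Type*} [NormedAddCommGroup W]
    [InnerProductSpace ℝ W] {a : X → W} {b : X → V} {A : X → V →L[ℝ] W}
    (ha : MemLp a 2 μ) (hb : MemLp b 2 μ) (hA : AEStronglyMeasurable A μ) {M : ℝ} (hM0 : 0 ≤ M)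
    (hM : ∀ x, ‖A x‖ ≤ M) :
    Integrable (fun x => ⟪a x, A x (b x)⟫) μ ∧
      |∫ x, ⟪a x, A x (b x)⟫ ∂μ| ≤ M * (eLpNorm a 2 μ).toReal * (eLpNorm b 2 μ).toReal := by
  lift M to ℝ≥0 using hM0
  obtain ⟨hAb, hle⟩ := memLp_clm_apply_of_norm_le hb hA hM
  refine ⟨FunctionSpaces.integrable_inner_of_eLpNorm_two_lt_top ha.1 hAb.1 ha.eLpNorm_lt_top
    hAb.eLpNorm_lt_top, ?_⟩
  refine (abs_integral_inner_le_toReal_eLpNorm_mul ha hAb).trans ?_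
  have h1 : (eLpNorm (fun x => A x (b x)) 2 μ).toReal ≤ M * (eLpNorm b 2 μ).toReal := by
    have := ENNReal.toReal_mono (ENNReal.mul_ne_top ENNReal.coe_ne_top hb.eLpNorm_ne_top) hle
    rwa [ENNReal.toReal_mul, ENNReal.coe_toReal] at this
  calc (eLpNorm a 2 μ).toReal * (eLpNorm (fun x => A x (b x)) 2 μ).toReal
      ≤ (eLpNorm a 2 μ).toReal * (M * (eLpNorm b 2 μ).toReal) :=
        mul_le_mul_of_nonneg_left h1 ENNReal.toReal_nonneg
    _ = M * (eLpNorm a 2 μ).toReal * (eLpNorm b 2 μ).toReal := by ring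

omit [NormedAddCommGroup E] [InnerProductSpace ℝ E] [FiniteDimensional ℝ E] [MeasurableSpace E]
  [BorelSpace E] in
/-- **Continuity of the pairing in the right factor**: if `fⱼ → g` in `L²` then
`∫ ⟪a, fⱼ⟫ → ∫ ⟪a, g⟫` for `a ∈ L²`. [folklore] -/
theorem tendsto_integral_inner_right_of_tendsto_eLpNorm {ι : Type*} {l : Filter ι}
    {a g : X → V} {f : ι → X → V} (ha : MemLp a 2 μ) (hf : ∀ᶠ j in l, MemLp (f j) 2 μ)
    (hg : MemLp g 2 μ) (h : Tendsto (fun j => eLpNorm (f j - g) 2 μ) l (𝓝 0)) :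
    Tendsto (fun j => ∫ x, ⟪a x, f j x⟫ ∂μ) l (𝓝 (∫ x, ⟪a x, g x⟫ ∂μ)) := by
  rw [tendsto_iff_edist_tendsto_0]
  have hbound : ∀ᶠ j in l, edist (∫ x, ⟪a x, f j x⟫ ∂μ) (∫ x, ⟪a x, g x⟫ ∂μ) ≤
      eLpNorm a 2 μ * eLpNorm (f j - g) 2 μ := by
    filter_upwards [hf] with j hfj
    have i1 := FunctionSpaces.integrable_inner_of_eLpNorm_two_lt_top ha.1 hfj.1
      ha.eLpNorm_lt_top hfj.eLpNorm_lt_top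
    have i2 := FunctionSpaces.integrable_inner_of_eLpNorm_two_lt_top ha.1 hg.1
      ha.eLpNorm_lt_top hg.eLpNorm_lt_top
    rw [edist_eq_enorm_sub, ← integral_sub i1 i2]
    have heq : (fun x => ⟪a x, f j x⟫ - ⟪a x, g x⟫) = fun x => ⟪a x, (f j - g) x⟫ := by
      ext x; rw [Pi.sub_apply, inner_sub_right]
    rw [heq]
    exact FunctionSpaces.enorm_integral_inner_le_eLpNorm_mul ha.1 (hfj.sub hg).1
  refine tendsto_of_tendsto_of_tendsto_of_le_of_le' tendsto_const_nhds ?_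
    (Eventually.of_forall fun _ => zero_le) hbound
  have := ENNReal.Tendsto.const_mul h (a := eLpNorm a 2 μ) (Or.inr ha.eLpNorm_ne_top)
  simpa only [mul_zero] using this

omit [NormedAddCommGroup E] [InnerProductSpace ℝ E] [FiniteDimensional ℝ E] [MeasurableSpace E]
  [BorelSpace E] in
/-- **Continuity of the pairing in the left factor**: if `fⱼ → g` in `L²` then
`∫ ⟪fⱼ, a⟫ → ∫ ⟪g, a⟫` for `a ∈ L²`. [folklore] -/
theorem tendsto_integral_inner_left_of_tendsto_eLpNorm {ι : Type*} {l : Filter ι}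
    {a g : X → V} {f : ι → X → V} (ha : MemLp a 2 μ) (hf : ∀ᶠ j in l, MemLp (f j) 2 μ)
    (hg : MemLp g 2 μ) (h : Tendsto (fun j => eLpNorm (f j - g) 2 μ) l (𝓝 0)) :
    Tendsto (fun j => ∫ x, ⟪f j x, a x⟫ ∂μ) l (𝓝 (∫ x, ⟪g x, a x⟫ ∂μ)) := by
  have h1 := tendsto_integral_inner_right_of_tendsto_eLpNorm ha hf hg h
  have hcomm : ∀ b : X → V, ∫ x, ⟪b x, a x⟫ ∂μ = ∫ x, ⟪a x, b x⟫ ∂μ := fun b =>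
    integral_congr_ae (ae_of_all _ fun _ => real_inner_comm _ _)
  simpa only [hcomm] using h1

end Pairings

/-! ### Leray–Hopf solutions tested with mollified `L²` solenoidal fields -/

section LerayHopf

variable {T ν : ℝ} {u₀ : E → E} {u : ℝ → E → E}

/-- The flux `s ↦ ∫ (⟪u, DΨ u⟫ + ν ⟪u, ΔΨ⟫)` of a jointly measurable field against a field with
continuous derivative and continuous Laplacian is a.e.-strongly measurable on `(0, T)`. [folklore] -/
theorem aestronglyMeasurable_flux_of_continuous
    (huj : AEStronglyMeasurable (uncurry u) (volume.restrict (Ioo 0 T ×ˢ univ)))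
    {Ψ : E → E} (hDΨ : Continuous (fderiv ℝ Ψ)) (hΔΨ : Continuous (Δ Ψ)) :
    AEStronglyMeasurable (fun s => ∫ x, (⟪u s x, fderiv ℝ Ψ x (u s x)⟫ + ν * ⟪u s x, (Δ Ψ) x⟫))
      (volume.restrict (Ioo 0 T)) := by
  have hu' : AEStronglyMeasurable (uncurry u)
      (((volume : Measure ℝ).restrict (Ioo 0 T)).prod (volume : Measure E)) := by
    rw [restrict_prod_volume_eq]; exact huj
  have hAu : AEStronglyMeasurable (fun p : ℝ × E => fderiv ℝ Ψ p.2 (uncurry u p))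
      (((volume : Measure ℝ).restrict (Ioo 0 T)).prod (volume : Measure E)) :=
    isBoundedBilinearMap_apply.continuous.comp_aestronglyMeasurable
      ((hDΨ.comp continuous_snd).aestronglyMeasurable.prodMk hu')
  have hL : AEStronglyMeasurable (fun p : ℝ × E => (Δ Ψ) p.2)
      (((volume : Measure ℝ).restrict (Ioo 0 T)).prod (volume : Measure E)) :=
    (hΔΨ.comp continuous_snd).aestronglyMeasurable
  have h1 : AEStronglyMeasurable
      (fun p : ℝ × E => ⟪uncurry u p, fderiv ℝ Ψ p.2 (uncurry u p)⟫ + ν * ⟪uncurry u p, (Δ Ψ) p.2⟫)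
      (((volume : Measure ℝ).restrict (Ioo 0 T)).prod (volume : Measure E)) :=
    (hu'.inner hAu).add ((hu'.inner hL).const_mul ν)
  exact h1.integral_prod_right'

/-- **A.e. `L²` bound in real form**: for a Leray–Hopf solution there is `R` with
`‖u(s)‖_{L²} ≤ R` for a.e. `s ∈ (0,T)` (from the `L^∞(0,T;L²)` clause). [folklore] -/
theorem IsLerayHopfOn.exists_toReal_eLpNorm_le {f : ℝ → E → E} (hu : IsLerayHopfOn T ν f u₀ u) :
    ∃ R : ℝ, 0 ≤ R ∧ ∀ᵐ s ∂(volume.restrict (Ioo 0 T)), (eLpNorm (u s) 2 volume).toReal ≤ R := by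
  obtain ⟨C, hC⟩ := hu.energy_bound
  refine ⟨((C : ℝ≥0∞) ^ (1 / 2 : ℝ)).toReal, ENNReal.toReal_nonneg, ?_⟩
  filter_upwards [hC] with s hs
  have h1 : eLpNorm (u s) 2 volume = (eEnergy (u s)) ^ (1 / 2 : ℝ) := by
    rw [eEnergy, eLpNorm_eq_lintegral_rpow_enorm_toReal two_ne_zero ENNReal.ofNat_ne_top,
      ENNReal.toReal_ofNat]
    congr 1
    exact lintegral_congr fun x => ENNReal.rpow_two _
  rw [h1]
  exact ENNReal.toReal_mono (ENNReal.rpow_ne_top_of_nonneg (by norm_num) ENNReal.coe_ne_top)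
    (ENNReal.rpow_le_rpow hs (by norm_num))

/-- **The time-sliced weak formulation of a Leray–Hopf solution, tested with a mollified
solenoidal `L²` field.** Let `u` be a Leray–Hopf weak solution of the unforced Navier–Stokes
system on `E × [0,T)`, `T > 0`, with datum `u₀ ∈ L²`, let `w ∈ L²(E;E)` be weakly divergence free
and `φ` a bump kernel. Then `Ψ = φ ⋆ w` satisfies, for every `t ∈ (0, T]`,
`⟨u(t), Ψ⟩ = ⟨u₀, Ψ⟩ + ∫_{(0,t]} ∫ (⟪u, DΨ u⟫ + ν ⟪u, ΔΨ⟫) dx ds`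
(Serrin 1963, §3, (6); Galdi 2000, Lemma 2.1, for the admissible non-compactly supported test
`Ψ`). Proof: approximate `w` by `ψⱼ ∈ 𝒱` in `L²` (`exists_divFreeTest_tendsto_eLpNorm`); for the
test fields `φ ⋆ ψⱼ` the identity is the accepted `IsLerayHopfOn.inner_test_eq`, and all terms
converge since `φ ⋆ ψⱼ → Ψ` in `L²`, `D(φ ⋆ ψⱼ) → DΨ` uniformly and `Δ(φ ⋆ ψⱼ) → ΔΨ` in `L²`
(the `L²` norms of `u(s)` being bounded a.e.). [cite: Serrin1963, §3 (6)] -/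
theorem IsLerayHopfOn.inner_normed_convolution_eq (hu : IsLerayHopfOn T ν 0 u₀ u) (hT : 0 < T)
    (hu₀ : MemLp u₀ 2 volume) (φ : ContDiffBump (0 : E)) {w : E → E} (hw : MemLp w 2 volume)
    (hwdiv : IsWeaklyDivFree w) {t : ℝ} (ht : t ∈ Ioc 0 T) :
    ∫ x, ⟪u t x, (φ.normed volume ⋆[lsmul ℝ ℝ, volume] w) x⟫ =
      (∫ x, ⟪u₀ x, (φ.normed volume ⋆[lsmul ℝ ℝ, volume] w) x⟫) +
      ∫ s in Ioc 0 t, ∫ x, (⟪u s x, fderiv ℝ (φ.normed volume ⋆[lsmul ℝ ℝ, volume] w) x (u s x)⟫ +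
        ν * ⟪u s x, (Δ (φ.normed volume ⋆[lsmul ℝ ℝ, volume] w)) x⟫) := by
  -- notation and basic facts
  set ρ : E → ℝ := φ.normed volume with hρ
  set Ψ : E → E := ρ ⋆[lsmul ℝ ℝ, volume] w with hΨ
  have hwl : LocallyIntegrable w volume := hw.locallyIntegrable one_le_two
  obtain ⟨ψ, hψ, hψlim⟩ := exists_divFreeTest_tendsto_eLpNorm hw hwdiv
  have hψ2 : ∀ j, MemLp (ψ j) 2 volume := fun j => memLp_of_mem_divFreeTest (hψ j) 2
  have hψl : ∀ j, LocallyIntegrable (ψ j) volume := fun j => (hψ2 j).locallyIntegrable one_le_two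
  set Ψj : ℕ → E → E := fun j => ρ ⋆[lsmul ℝ ℝ, volume] ψ j with hΨj
  have hΨjV : ∀ j, Ψj j ∈ divFreeTest E := fun j => normed_convolution_mem_divFreeTest φ (hψ j)
  -- the differences `Ψⱼ - Ψ = φ ⋆ (ψⱼ - w)`
  set Dj : ℕ → E → E := fun j => ρ ⋆[lsmul ℝ ℝ, volume] (ψ j - w) with hDj
  have hDj_eq : ∀ j, Ψj j - Ψ = Dj j := fun j => (normed_convolution_sub φ (hψl j) hwl).symm
  have hd2 : ∀ j, MemLp (ψ j - w) 2 volume := fun j => (hψ2 j).sub hw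
  -- `L²` memberships
  have hΨ2 : MemLp Ψ 2 volume := FunctionSpaces.memLp_normed_convolution φ hw one_le_two
  have hΨj2 : ∀ j, MemLp (Ψj j) 2 volume := fun j =>
    FunctionSpaces.memLp_normed_convolution φ (hψ2 j) one_le_two
  have hDj2 : ∀ j, MemLp (Dj j) 2 volume := fun j =>
    FunctionSpaces.memLp_normed_convolution φ (hd2 j) one_le_two
  have hDjlim : Tendsto (fun j => eLpNorm (Dj j) 2 volume) atTop (𝓝 0) :=
    tendsto_of_tendsto_of_tendsto_of_le_of_le tendsto_const_nhds hψlim (fun _ => zero_le)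
      fun j => FunctionSpaces.eLpNorm_normed_convolution_le φ (hd2 j).1 one_le_two
  have hΨjlim : Tendsto (fun j => eLpNorm (Ψj j - Ψ) 2 volume) atTop (𝓝 0) := by
    simpa only [hDj_eq] using hDjlim
  -- smoothness
  have hΨs : ContDiff ℝ 2 Ψ := contDiff_normed_convolution_of_locallyIntegrable φ hwl
  have hΨjs : ∀ j, ContDiff ℝ 2 (Ψj j) := fun j => contDiff_normed_convolution_of_locallyIntegrable φ (hψl j)
  have hDjs : ∀ j, ContDiff ℝ 2 (Dj j) := fun j =>
    contDiff_normed_convolution_of_locallyIntegrable φ ((hd2 j).locallyIntegrable one_le_two)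
  have hΨd : Differentiable ℝ Ψ := hΨs.differentiable (by norm_num)
  have hDjd : ∀ j, Differentiable ℝ (Dj j) := fun j => (hDjs j).differentiable (by norm_num)
  have hDΨc : Continuous (fderiv ℝ Ψ) := hΨs.continuous_fderiv two_ne_zero
  have hDDjc : ∀ j, Continuous (fderiv ℝ (Dj j)) := fun j => (hDjs j).continuous_fderiv two_ne_zero
  have hΔΨc : Continuous (Δ Ψ) := continuous_laplacian hΨs
  -- the constants
  set K₁ : ℝ := (eLpNorm (fderiv ℝ ρ) 2 volume).toReal with hK₁
  set K₂ : ℝ≥0∞ := ∫⁻ y, ‖(Δ ρ) y‖ₑ with hK₂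
  have hK₂ : K₂ ≠ ⊤ := (integrable_laplacian_normed φ).2.ne
  set d : ℕ → ℝ := fun j => (eLpNorm (ψ j - w) 2 volume).toReal with hd
  have hd0 : ∀ j, 0 ≤ d j := fun j => ENNReal.toReal_nonneg
  have hdlim : Tendsto d atTop (𝓝 0) := by
    rw [← ENNReal.toReal_zero]
    exact (ENNReal.tendsto_toReal ENNReal.zero_ne_top).comp hψlim
  have hK₁0 : 0 ≤ K₁ := ENNReal.toReal_nonneg
  -- bounds on the derivatives of `Ψ` and `Dⱼ`
  have bΨ : ∀ x, ‖fderiv ℝ Ψ x‖ ≤ K₁ * (eLpNorm w 2 volume).toReal := fun x =>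
    norm_fderiv_normed_convolution_le φ hw x
  have bD : ∀ j x, ‖fderiv ℝ (Dj j) x‖ ≤ K₁ * d j := fun j x =>
    norm_fderiv_normed_convolution_le φ (hd2 j) x
  obtain ⟨hΔΨ2, -⟩ := memLp_laplacian_normed_convolution φ hw
  have hΔD2 : ∀ j, MemLp (Δ (Dj j)) 2 volume ∧ (eLpNorm (Δ (Dj j)) 2 volume).toReal ≤ K₂.toReal * d j := by
    intro j
    obtain ⟨h1, h2⟩ := memLp_laplacian_normed_convolution φ (hd2 j)
    refine ⟨h1, ?_⟩
    have := ENNReal.toReal_mono (ENNReal.mul_ne_top hK₂ (hd2 j).eLpNorm_ne_top) h2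
    rwa [ENNReal.toReal_mul] at this
  -- derivative and Laplacian of the differences
  have hDsub : ∀ j x, fderiv ℝ (Ψj j) x - fderiv ℝ Ψ x = fderiv ℝ (Dj j) x := by
    intro j x
    have h1 : Ψj j = Dj j + Ψ := by rw [← hDj_eq j, sub_add_cancel]
    rw [h1, fderiv_add (hDjd j x) (hΨd x)]
    simp
  have hΔsub : ∀ j x, (Δ (Ψj j)) x - (Δ Ψ) x = (Δ (Dj j)) x := by
    intro j x
    have hρ2 : ContDiff ℝ 2 ρ := φ.contDiff_normed
    have hρc : HasCompactSupport ρ := φ.hasCompactSupport_normed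
    rw [show Ψj j = ρ ⋆[lsmul ℝ ℝ, volume] ψ j from rfl,
      laplacian_convolution_lsmul hρ2 hρc (hψl j) x, laplacian_convolution_lsmul hρ2 hρc hwl x,
      show Dj j = ρ ⋆[lsmul ℝ ℝ, volume] (ψ j - w) from rfl,
      laplacian_convolution_lsmul hρ2 hρc ((hd2 j).locallyIntegrable one_le_two) x,
      convolution_lsmul_sub (continuous_laplacian hρ2) (hasCompactSupport_laplacian_normed φ)
        (hψl j) hwl, Pi.sub_apply]
  -- the identity for the test fields `Ψⱼ`
  set Fl : ℕ → ℝ → ℝ := fun j s =>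
    ∫ x, (⟪u s x, fderiv ℝ (Ψj j) x (u s x)⟫ + ν * ⟪u s x, (Δ (Ψj j)) x⟫) with hFl
  set F : ℝ → ℝ := fun s => ∫ x, (⟪u s x, fderiv ℝ Ψ x (u s x)⟫ + ν * ⟪u s x, (Δ Ψ) x⟫) with hF
  have hid : ∀ j, ∫ x, ⟪u t x, Ψj j x⟫ = (∫ x, ⟪u₀ x, Ψj j x⟫) + ∫ s in Ioc 0 t, Fl j s :=
    fun j => hu.inner_test_eq hT (hΨjV j).1 (hΨjV j).2 ht
  -- ### limits of the boundary terms
  have hmemt : MemLp (u t) 2 volume := hu.memLp t ⟨ht.1.le, ht.2⟩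
  have hL : Tendsto (fun j => ∫ x, ⟪u t x, Ψj j x⟫) atTop (𝓝 (∫ x, ⟪u t x, Ψ x⟫)) :=
    tendsto_integral_inner_right_of_tendsto_eLpNorm hmemt (Eventually.of_forall hΨj2) hΨ2 hΨjlim
  have hL0 : Tendsto (fun j => ∫ x, ⟪u₀ x, Ψj j x⟫) atTop (𝓝 (∫ x, ⟪u₀ x, Ψ x⟫)) :=
    tendsto_integral_inner_right_of_tendsto_eLpNorm hu₀ (Eventually.of_forall hΨj2) hΨ2 hΨjlim
  -- ### the flux difference, slice-wise
  have hslice : ∀ j, ∀ s ∈ Icc 0 T, |Fl j s - F s| ≤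
      K₁ * d j * (eLpNorm (u s) 2 volume).toReal ^ 2 +
        |ν| * ((eLpNorm (u s) 2 volume).toReal * (K₂.toReal * d j)) := by
    intro j s hs
    have hus : MemLp (u s) 2 volume := hu.memLp s hs
    set N : ℝ := (eLpNorm (u s) 2 volume).toReal with hN
    -- integrability of the four pieces
    obtain ⟨i1, -⟩ := abs_integral_inner_clm_apply_le_of_norm_le hus hus
      ((hΨjs j).continuous_fderiv two_ne_zero).aestronglyMeasurable (by positivity)
      (fun x => norm_fderiv_normed_convolution_le φ (hψ2 j) x)
    obtain ⟨i2, -⟩ := abs_integral_inner_clm_apply_le_of_norm_le hus hus hDΨc.aestronglyMeasurable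
      (by positivity) bΨ
    obtain ⟨i3, b3⟩ := abs_integral_inner_clm_apply_le_of_norm_le hus hus
      (hDDjc j).aestronglyMeasurable (mul_nonneg hK₁0 (hd0 j)) (bD j)
    have i4 : Integrable (fun x => ⟪u s x, (Δ (Ψj j)) x⟫) volume :=
      integrable_inner_of_memLp_two hus ((hΨjV j).1.memLp_laplacian 2)
    have i5 : Integrable (fun x => ⟪u s x, (Δ Ψ) x⟫) volume := integrable_inner_of_memLp_two hus hΔΨ2
    have i6 : Integrable (fun x => ⟪u s x, (Δ (Dj j)) x⟫) volume :=
      integrable_inner_of_memLp_two hus (hΔD2 j).1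
    have hdiff : Fl j s - F s =
        (∫ x, ⟪u s x, fderiv ℝ (Dj j) x (u s x)⟫) + ν * ∫ x, ⟪u s x, (Δ (Dj j)) x⟫ := by
      have e1 : (∫ x, ⟪u s x, fderiv ℝ (Ψj j) x (u s x)⟫) - ∫ x, ⟪u s x, fderiv ℝ Ψ x (u s x)⟫ =
          ∫ x, ⟪u s x, fderiv ℝ (Dj j) x (u s x)⟫ := by
        rw [← integral_sub i1 i2]
        refine integral_congr_ae (ae_of_all _ fun x => ?_)
        dsimp only
        rw [← inner_sub_right, ← sub_apply, hDsub j x]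
      have e2 : (∫ x, ⟪u s x, (Δ (Ψj j)) x⟫) - ∫ x, ⟪u s x, (Δ Ψ) x⟫ =
          ∫ x, ⟪u s x, (Δ (Dj j)) x⟫ := by
        rw [← integral_sub i4 i5]
        refine integral_congr_ae (ae_of_all _ fun x => ?_)
        dsimp only
        rw [← inner_sub_right, hΔsub j x]
      simp only [hFl, hF]
      rw [integral_add i1 (i4.const_mul ν), integral_add i2 (i5.const_mul ν), integral_const_mul,
        integral_const_mul, ← e1, ← e2]
      ring
    rw [hdiff]
    have b3' : |∫ x, ⟪u s x, fderiv ℝ (Dj j) x (u s x)⟫| ≤ K₁ * d j * N ^ 2 :=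
      b3.trans_eq (by rw [hN]; ring)
    refine (abs_add_le _ _).trans (add_le_add b3' ?_)
    rw [abs_mul]
    refine mul_le_mul_of_nonneg_left ?_ (abs_nonneg ν)
    exact (abs_integral_inner_le_toReal_eLpNorm_mul hus (hΔD2 j).1).trans
      (mul_le_mul_of_nonneg_left (hΔD2 j).2 ENNReal.toReal_nonneg)
  -- ### uniform smallness on `(0, t)` and the limit of the flux integrals
  obtain ⟨R, hR0, hR⟩ := hu.exists_toReal_eLpNorm_le
  set δ : ℕ → ℝ := fun j => K₁ * d j * R ^ 2 + |ν| * (R * (K₂.toReal * d j)) with hδ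
  have hδlim : Tendsto δ atTop (𝓝 0) := by
    have h1 : Tendsto (fun j => K₁ * d j * R ^ 2) atTop (𝓝 (K₁ * 0 * R ^ 2)) :=
      (hdlim.const_mul K₁).mul_const _
    have h2 : Tendsto (fun j => |ν| * (R * (K₂.toReal * d j))) atTop
        (𝓝 (|ν| * (R * (K₂.toReal * 0)))) :=
      ((hdlim.const_mul _).const_mul R).const_mul _
    simpa using h1.add h2
  have hae : ∀ j, ∀ᵐ s ∂(volume.restrict (Ioc 0 t)), ‖Fl j s - F s‖ ≤ δ j := by
    intro j
    have hsub : Ioc 0 t ⊆ Icc 0 T := fun s hs => ⟨hs.1.le, hs.2.trans ht.2⟩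
    have hR' : ∀ᵐ s ∂(volume.restrict (Ioc 0 t)), (eLpNorm (u s) 2 volume).toReal ≤ R := by
      rw [← restrict_Ioo_eq_restrict_Ioc]
      exact ae_restrict_of_ae_restrict_of_subset (Ioo_subset_Ioo le_rfl ht.2) hR
    filter_upwards [hR', ae_restrict_mem measurableSet_Ioc] with s hs hsI
    rw [Real.norm_eq_abs]
    refine (hslice j s (hsub hsI)).trans ?_
    have hN0 : 0 ≤ (eLpNorm (u s) 2 volume).toReal := ENNReal.toReal_nonneg
    simp only [hδ]
    gcongr
  -- integrability of the fluxes on `(0, t]`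
  have hsubT : Ioo 0 t ⊆ Ioo 0 T := Ioo_subset_Ioo le_rfl ht.2
  have hFlint : ∀ j, IntegrableOn (Fl j) (Ioc 0 t) := fun j => by
    rw [integrableOn_Ioc_iff_integrableOn_Ioo]
    exact (hu.integrableOn_flux (hΨjV j).1).mono_set hsubT
  have hFint : IntegrableOn F (Ioc 0 t) := by
    rw [integrableOn_Ioc_iff_integrableOn_Ioo]
    refine IntegrableOn.mono_set (t := Ioo 0 T) ?_ hsubT
    refine ⟨aestronglyMeasurable_flux_of_continuous hu.weak.1 hDΨc hΔΨc, ?_⟩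
    refine HasFiniteIntegral.of_bounded (C := K₁ * (eLpNorm w 2 volume).toReal * R ^ 2 +
      |ν| * (R * (eLpNorm (Δ Ψ) 2 volume).toReal)) ?_
    filter_upwards [hR, ae_restrict_mem measurableSet_Ioo] with s hs hsI
    have hus : MemLp (u s) 2 volume := hu.memLp s (Ioo_subset_Icc_self hsI)
    obtain ⟨i2, b2⟩ := abs_integral_inner_clm_apply_le_of_norm_le hus hus hDΨc.aestronglyMeasurable
      (by positivity) bΨ
    have i5 : Integrable (fun x => ⟪u s x, (Δ Ψ) x⟫) volume := integrable_inner_of_memLp_two hus hΔΨ2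
    rw [Real.norm_eq_abs, hF]
    dsimp only
    rw [integral_add i2 (i5.const_mul ν), integral_const_mul]
    refine (abs_add_le _ _).trans (add_le_add ?_ ?_)
    · refine b2.trans ?_
      have hN0 : 0 ≤ (eLpNorm (u s) 2 volume).toReal := ENNReal.toReal_nonneg
      nlinarith [mul_le_mul hs hs hN0 hR0, mul_nonneg hK₁0 (ENNReal.toReal_nonneg (a := eLpNorm w 2 volume))]
    · rw [abs_mul]
      refine mul_le_mul_of_nonneg_left ?_ (abs_nonneg ν)
      exact (abs_integral_inner_le_toReal_eLpNorm_mul hus hΔΨ2).trans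
        (mul_le_mul_of_nonneg_right hs ENNReal.toReal_nonneg)
  have hflux : Tendsto (fun j => ∫ s in Ioc 0 t, Fl j s) atTop (𝓝 (∫ s in Ioc 0 t, F s)) := by
    have hbound : ∀ j, |(∫ s in Ioc 0 t, Fl j s) - ∫ s in Ioc 0 t, F s| ≤ δ j * t := by
      intro j
      rw [← integral_sub (hFlint j) hFint]
      have h := norm_setIntegral_le_of_norm_le_const_ae (measure_Ioc_lt_top (a := (0 : ℝ)) (b := t)) (hae j)
      rw [Real.norm_eq_abs, Measure.real, Real.volume_Ioc, ENNReal.toReal_ofReal (by linarith [ht.1])] at h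
      simpa only [sub_zero] using h
    rw [Metric.tendsto_atTop]
    intro ε hε
    have hδt : Tendsto (fun j => δ j * t) atTop (𝓝 0) := by simpa using hδlim.mul_const t
    obtain ⟨N, hN⟩ := Metric.tendsto_atTop.1 hδt ε hε
    refine ⟨N, fun j hj => ?_⟩
    have h1 := hN j hj
    rw [Real.dist_eq, sub_zero] at h1
    rw [Real.dist_eq]
    exact (hbound j).trans_lt (lt_of_abs_lt h1)
  -- ### conclusion
  have hlim := hL0.add hflux
  have heq : (fun j => ∫ x, ⟪u t x, Ψj j x⟫) = fun j => (∫ x, ⟪u₀ x, Ψj j x⟫) + ∫ s in Ioc 0 t, Fl j s :=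
    funext hid
  rw [← heq] at hlim
  exact tendsto_nhds_unique hL hlim

end LerayHopf

/-! ### Weak solutions continuous into `L²`: the time-sliced formulation on `[0, T]` -/

section Continuous

variable {T ν : ℝ} {u₀ : E → E} {u : ℝ → E → E}

/-- **Uniform `L²` bound** for a field continuous into `L²` on `[0, T]`:
`sup_{s ∈ [0,T]} ‖u(s)‖_{L²} < ∞` (continuity of the `L²`-valued lift on a compact interval). [folklore] -/
theorem ContinuousInLpOn.exists_toReal_eLpNorm_le_of_Icc (hc : ContinuousInLpOn (Icc 0 T) 2 u) :
    ∃ R : ℝ, 0 ≤ R ∧ ∀ s ∈ Icc 0 T, (eLpNorm (u s) 2 volume).toReal ≤ R := by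
  obtain ⟨U, hUc, hU⟩ := hc.exists_continuousOn_toLp
  obtain ⟨C, hC⟩ := isCompact_Icc.exists_bound_of_continuousOn hUc
  refine ⟨max C 0, le_max_right _ _, fun s hs => ?_⟩
  have h := hC s hs
  rw [hU s hs, Lp.norm_toLp] at h
  exact h.trans (le_max_left _ _)

/-- The pairing `s ↦ ⟨u(s), Ψ⟩` of a field continuous into `L²` with an `L²` field is continuous
on the time interval. [folklore] -/
theorem ContinuousInLpOn.continuousOn_integral_inner {S : Set ℝ} (hc : ContinuousInLpOn S 2 u)
    {Ψ : E → E} (hΨ : MemLp Ψ 2 volume) :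
    ContinuousOn (fun s => ∫ x, ⟪u s x, Ψ x⟫) S := by
  intro s₀ hs₀
  have hev : ∀ᶠ s in 𝓝[S] s₀, MemLp (u s) 2 volume :=
    eventually_mem_nhdsWithin.mono fun s hs => hc.1 s hs
  exact tendsto_integral_inner_left_of_tendsto_eLpNorm hΨ hev (hc.1 s₀ hs₀) (hc.2 s₀ hs₀)

/-- **The time-sliced weak formulation of a weak solution continuous into `L²`.** Let `u` be a
weak solution of the unforced Navier–Stokes/Euler system on `E × [0, T)`, `T > 0`, with datum `u₀`
(accepted `IsWeakNSSolutionOn`, `f = 0`) such that `u ∈ C([0,T]; L²)` (`ContinuousInLpOn`). Then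
for every smooth compactly supported divergence-free `Ψ` and **every** `t ∈ [0, T]`
`⟨u(t), Ψ⟩ = ⟨u₀, Ψ⟩ + ∫_{(0,t]} ∫ (⟪u, (u·∇)Ψ⟫ + ν ⟪u, ΔΨ⟫) dx ds`
(Serrin 1963, §3, (6); Galdi 2000, Lemma 2.1); in particular `⟨u(0), Ψ⟩ = ⟨u₀, Ψ⟩`.
Proof: `IsWeakNSSolutionOn.test_smul` and the du Bois-Reymond lemma with initial datum
(`FunctionSpaces.eq_add_setIntegral_of_forall_test`), the continuous representative being
`s ↦ ⟨u(s), Ψ⟩` itself; the endpoints by one-sided limits. [cite: Serrin1963, §3 (6)] -/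
theorem IsWeakNSSolutionOn.inner_test_eq_of_continuousInLpOn (hu : IsWeakNSSolutionOn T ν 0 u₀ u)
    (hc : ContinuousInLpOn (Icc 0 T) 2 u) (hT : 0 < T) {Ψ : E → E}
    (hΨ : FunctionSpaces.IsTestFunctionOn (⊤ : Opens E) Ψ) (hΨdiv : VectorCalculus.IsDivFree Ψ)
    {t : ℝ} (ht : t ∈ Icc 0 T) :
    ∫ x, ⟪u t x, Ψ x⟫ = (∫ x, ⟪u₀ x, Ψ x⟫) +
      ∫ s in Ioc 0 t, ∫ x, (⟪u s x, convect (u s) Ψ x⟫ + ν * ⟪u s x, (Δ Ψ) x⟫) := by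
  have hL2 : ∀ s ∈ Icc 0 T, MemLp (u s) 2 volume := hc.1
  obtain ⟨R, hR0, hR⟩ := hc.exists_toReal_eLpNorm_le_of_Icc
  obtain ⟨D, hD⟩ := hΨ.exists_norm_fderiv_le
  have hD0 : 0 ≤ D := (norm_nonneg _).trans (hD 0)
  have hΨ2 : ContDiff ℝ 2 Ψ := contDiff_infty.1 hΨ.contDiff 2
  have hDΨc : Continuous (fderiv ℝ Ψ) := hΨ.contDiff.continuous_fderiv (by simp)
  -- the two functions of time
  set U : ℝ → ℝ := fun s => ∫ x, ⟪u s x, Ψ x⟫ with hU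
  set F : ℝ → ℝ := fun s => ∫ x, (⟪u s x, convect (u s) Ψ x⟫ + ν * ⟪u s x, (Δ Ψ) x⟫) with hF
  have hUcont : ContinuousOn U (Icc 0 T) := hc.continuousOn_integral_inner (hΨ.memLp_volume 2)
  have hUint : IntegrableOn U (Ioo 0 T) :=
    (hUcont.integrableOn_compact isCompact_Icc).mono_set Ioo_subset_Icc_self
  have hFint : IntegrableOn F (Ioo 0 T) := by
    refine ⟨aestronglyMeasurable_flux_of_continuous hu.1 hDΨc (continuous_laplacian hΨ2), ?_⟩
    refine HasFiniteIntegral.of_bounded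
      (C := D * R * R + |ν| * (R * (eLpNorm (Δ Ψ) 2 volume).toReal)) ?_
    filter_upwards [ae_restrict_mem measurableSet_Ioo] with s hsI
    have hs : s ∈ Icc 0 T := Ioo_subset_Icc_self hsI
    have hus : MemLp (u s) 2 volume := hL2 s hs
    obtain ⟨i1, b1⟩ := abs_integral_inner_clm_apply_le_of_norm_le hus hus hDΨc.aestronglyMeasurable
      hD0 hD
    have i2 : Integrable (fun x => ⟪u s x, (Δ Ψ) x⟫) volume :=
      integrable_inner_of_memLp_two hus (hΨ.memLp_laplacian 2)
    rw [Real.norm_eq_abs, hF]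
    dsimp only
    simp only [convect_apply]
    rw [integral_add i1 (i2.const_mul ν), integral_const_mul]
    refine (abs_add_le _ _).trans (add_le_add ?_ ?_)
    · refine b1.trans ?_
      have hN0 : 0 ≤ (eLpNorm (u s) 2 volume).toReal := ENNReal.toReal_nonneg
      have h1 := hR s hs
      have := mul_le_mul h1 h1 hN0 hR0
      nlinarith
    · rw [abs_mul]
      refine mul_le_mul_of_nonneg_left ?_ (abs_nonneg ν)
      exact (abs_integral_inner_le_toReal_eLpNorm_mul hus (hΨ.memLp_laplacian 2)).trans
        (mul_le_mul_of_nonneg_right (hR s hs) ENNReal.toReal_nonneg)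
  have hid : ∀ η : ℝ → ℝ, ContDiff ℝ (⊤ : ℕ∞) η → HasCompactSupport η → tsupport η ⊆ Iio T →
      (∫ s in Ioo 0 T, (deriv η s * U s + η s * F s)) + η 0 * (∫ x, ⟪u₀ x, Ψ x⟫) = 0 :=
    fun η hη hηc hηT => hu.test_smul (fun s hs => hL2 s (Ioo_subset_Icc_self hs)) hΨ hΨdiv hη hηc hηT
  have hIoo : ∀ τ ∈ Ioo 0 T, U τ = (∫ x, ⟪u₀ x, Ψ x⟫) + ∫ s in Ioc 0 τ, F s := fun τ hτ =>
    FunctionSpaces.eq_add_setIntegral_of_forall_test hUint hFint (hUcont.mono Ioo_subset_Icc_self)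
      hid hτ
  -- the three cases `t ∈ (0,T)`, `t = T`, `t = 0`
  rcases eq_or_lt_of_le ht.1 with h0 | ht0
  · -- `t = 0`: right limits at `0`
    subst h0
    haveI : (𝓝[Ioo 0 T] (0 : ℝ)).NeBot := by
      refine mem_closure_iff_nhdsWithin_neBot.1 ?_
      rw [closure_Ioo hT.ne]
      exact left_mem_Icc.2 hT.le
    have h1 : Tendsto U (𝓝[Ioo 0 T] 0) (𝓝 (U 0)) :=
      (hUcont 0 (left_mem_Icc.2 hT.le)).mono_left (nhdsWithin_mono _ Ioo_subset_Icc_self)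
    have hFint' : IntegrableOn F (Icc 0 T) :=
      (integrableOn_Icc_iff_integrableOn_Ioo (by simp) (by simp)).2 hFint
    have h2 : Tendsto (fun τ => (∫ x, ⟪u₀ x, Ψ x⟫) + ∫ s in Ioc 0 τ, F s) (𝓝[Ioo 0 T] 0)
        (𝓝 ((∫ x, ⟪u₀ x, Ψ x⟫) + ∫ s in Ioc 0 0, F s)) := by
      have hprim : ContinuousWithinAt (fun τ => ∫ s in Ioc 0 τ, F s) (Ioo 0 T) 0 :=
        (intervalIntegral.continuousOn_primitive hFint' 0 (left_mem_Icc.2 hT.le)).mono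
          Ioo_subset_Icc_self
      exact tendsto_const_nhds.add hprim
    have heq : U =ᶠ[𝓝[Ioo 0 T] 0] fun τ => (∫ x, ⟪u₀ x, Ψ x⟫) + ∫ s in Ioc 0 τ, F s :=
      eventually_mem_nhdsWithin.mono fun τ hτ => hIoo τ hτ
    have := tendsto_nhds_unique (h1.congr' heq) h2
    simpa using this
  rcases lt_or_eq_of_le ht.2 with htT | rfl
  · exact hIoo t ⟨ht0, htT⟩
  · -- the endpoint `t = T`: left limits
    haveI : (𝓝[Ioo 0 t] t).NeBot := by
      refine mem_closure_iff_nhdsWithin_neBot.1 ?_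
      rw [closure_Ioo hT.ne]
      exact right_mem_Icc.2 hT.le
    have h1 : Tendsto U (𝓝[Ioo 0 t] t) (𝓝 (U t)) :=
      (hUcont t ⟨hT.le, le_rfl⟩).mono_left (nhdsWithin_mono _ Ioo_subset_Icc_self)
    have hFint' : IntegrableOn F (Icc 0 t) :=
      (integrableOn_Icc_iff_integrableOn_Ioo (by simp) (by simp)).2 hFint
    have h2 : Tendsto (fun τ => (∫ x, ⟪u₀ x, Ψ x⟫) + ∫ s in Ioc 0 τ, F s) (𝓝[Ioo 0 t] t)
        (𝓝 ((∫ x, ⟪u₀ x, Ψ x⟫) + ∫ s in Ioc 0 t, F s)) := by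
      have hprim : ContinuousWithinAt (fun τ => ∫ s in Ioc 0 τ, F s) (Ioo 0 t) t :=
        (intervalIntegral.continuousOn_primitive hFint' t (right_mem_Icc.2 hT.le)).mono
          Ioo_subset_Icc_self
      exact tendsto_const_nhds.add hprim
    have heq : U =ᶠ[𝓝[Ioo 0 t] t] fun τ => (∫ x, ⟪u₀ x, Ψ x⟫) + ∫ s in Ioc 0 τ, F s :=
      eventually_mem_nhdsWithin.mono fun τ hτ => hIoo τ hτ
    exact tendsto_nhds_unique (h1.congr' heq) h2

/-- **The initial datum of a weak solution continuous into `L²`** is orthogonal-to-nothing: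
`⟨u(0), Ψ⟩ = ⟨u₀, Ψ⟩` for every smooth compactly supported divergence-free `Ψ`
(`inner_test_eq_of_continuousInLpOn` at `t = 0`). [folklore] -/
theorem IsWeakNSSolutionOn.integral_inner_zero_eq_of_continuousInLpOn
    (hu : IsWeakNSSolutionOn T ν 0 u₀ u) (hc : ContinuousInLpOn (Icc 0 T) 2 u) (hT : 0 < T)
    {Ψ : E → E} (hΨ : FunctionSpaces.IsTestFunctionOn (⊤ : Opens E) Ψ)
    (hΨdiv : VectorCalculus.IsDivFree Ψ) :
    ∫ x, ⟪u 0 x, Ψ x⟫ = ∫ x, ⟪u₀ x, Ψ x⟫ := by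
  have h := hu.inner_test_eq_of_continuousInLpOn hc hT hΨ hΨdiv (left_mem_Icc.2 hT.le)
  simpa using h

end Continuous

end Literature.Analysis.FluidPDE
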